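import Summits.CriticalPhenomena.PercolationContinuityZ3.Theorems.PercNearOneGluingNoHeavyPcintWinKernelCert
import HarnessLib

/-!
# PCINT lane, kernel B2r window certificate `d = 4`, memory 5 (4-step windows, 4096 codes) — table and chunk check

Cell `prim-pcint`, seat `prim-pcint-2` (gen 2); memo `run/shared/lean/prim/pcint/REDUCTIONS.md` §B2r, INTERVAL-PLAN §14.
Does NOT build on p205010.  Instance data for the generic theorem
`WinK.le_siteCriticalProb_of_checkS`: `p = 1664/10^4`, `q̄ = 9744/10^4` (`q̄^7 ≥ 1-p`), `κ̄ = (10^4+9744)/(2·10^4)`; Collatz–Wielandt vector on the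
17 hyperoctahedral normal forms (integer scale `10^5`, found by power iteration and verified in exact arithmetic
off-line: max row ratio `1220653018/1220703125` < 1; `λ = 99999/10^5`).  The `4096` coded rows are checked by `decide +kernel` in
`…KernZ4S5Check*`; result in `…KernZ4S5`: `p_c^site(ℤ⁴) ≥ 0.1664`.
-/

namespace Summit.CriticalPhenomena.PercolationContinuityZ3.Theorems.Pcint

namespace Z4S5

/-- The certificate table `normal-form code ↦ v`. [folklore] -/
def tbl : List (ℕ × ℕ) := [(0, 100000), (16, 99820), (128, 84572), (144, 84572), (272, 82281), (656, 84572), (784, 71055), (1024, 84572), (1040, 84572), (1152, 99820), (1168, 100000), (1296, 84572), (2064, 82281), (2176, 82281), (2192, 84572), (2320, 99820), (3344, 82281)]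

/-- All table values lie in `[71055, 100000]`. [folklore] -/
theorem tbl_bounds : ∀ e ∈ tbl, 71055 ≤ e.2 ∧ e.2 ≤ 100000 := by decide

/-- The Collatz–Wielandt row check on the window codes `[lo, hi)`. [folklore] -/
def chk (lo hi : ℕ) : Bool := WinK.allRange (WinK.rowOKS 4 3 1664 9744 99999 tbl 71055) lo hi

/-- Splitting a chunk check. [folklore] -/
theorem chk_split {lo mid hi : ℕ} (h1 : chk lo mid = true) (h2 : chk mid hi = true) : chk lo hi = true :=
  WinK.allRange_split h1 h2

end Z4S5

end Summit.CriticalPhenomena.PercolationContinuityZ3.Theorems.Pcint
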